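import Mathlib.MeasureTheory.Integral.IntervalIntegral.AbsolutelyContinuousFun
import Mathlib.MeasureTheory.Integral.IntervalIntegral.LebesgueDifferentiationThm
import Mathlib.Analysis.SpecialFunctions.ExpDeriv
import Mathlib.Analysis.SpecialFunctions.Integrals.Basic
import HarnessLib

/-!
# Scalar energy calculus for integral identities: squares of absolutely continuous functions,
# a dissipative integral inequality, and continuous representatives vanishing a.e.

Analysis/FluidPDE support file (folklore real analysis; serves the discharge of Marchioro's
theorem `Literature.Barriers.AnomalousDissipation.Marchioro1986_globalAttraction`, Foias–Manley–Rosa–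
Temam 2001, App. III.A.4, and the 2-D uniqueness fact `Literature.Analysis.FluidPDE.lions_prodi_uniqueness_torus2`).
Everything here is independent of the Navier–Stokes equations.

Weak formulations deliver scalar identities of the form `V(t) - V(s) = ∫ₛᵗ G` with `G ∈ L¹`
(the time-sliced equations for the Fourier modes of a Leray–Hopf solution), never pointwise
derivatives. The three lemmas of this file are the calculus that the printed arguments perform
on such identities ("`½ d/dt |P₄v|² + νλ₁|P₄v|² = β(t)`, whence `|P₄v(t)| → 0`", FMRT 2001,
App. III.A.4, PDF p. 180; Temam 1984, Ch. III, Lemma 1.2 for the energy equality of an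
absolutely continuous quantity):

* `Literature.Analysis.FluidPDE.sq_sub_sq_eq_integral_of_sub_eq_integral` — if `V` satisfies `V τ - V s = ∫ₛ^τ G` on
  `[s, t]` with `G` integrable, then `V t² - V s² = 2 ∫ₛᵗ G V` (the function
  `τ ↦ V s + ∫ₛ^τ G` is absolutely continuous with a.e. derivative `G`, Lebesgue's
  differentiation theorem, and Mathlib's product rule for absolutely continuous functions
  `AbsolutelyContinuousOnInterval.integral_deriv_mul_eq_sub`);
* `Literature.Analysis.FluidPDE.tendsto_zero_of_integral_dissipative` — if `y ≥ 0` is continuous on `[s₀, ∞)`,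
  `y t - y s = ∫ₛᵗ g` with `g` locally integrable and `g + c y ≤ ε` a.e. eventually for every
  `ε > 0` (`c > 0`), then `y(t) → 0` as `t → ∞` (integrating factor `e^{ct}`:
  `y(t) ≤ e^{-c(t-s)} y(s) + ε/c`);
* `Literature.Analysis.FluidPDE.eq_zero_of_continuousOn_Ioc_of_ae_eq_zero` — a function continuous on `(a, b]` which
  vanishes a.e. on `(a, b)` vanishes everywhere on `(a, b]` (used to upgrade a.e.-in-time
  properties of weakly continuous solutions, e.g. weak divergence-freeness, to every time).

## Mathlib search

Mathlib (this pin) has absolutely continuous functions on intervals with the fundamental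
theorem of calculus and the product rule (`AbsolutelyContinuousOnInterval.integral_deriv_eq_sub`,
`…integral_deriv_mul_eq_sub`, `IntervalIntegrable.absolutelyContinuousOnInterval_intervalIntegral`),
Lebesgue's differentiation theorem in interval form (`IntervalIntegrable.ae_hasDerivAt_integral`)
and Grönwall bounds for differentiable functions (`Mathlib.Analysis.ODE.Gronwall`), but no
statement for functions given only through integral identities (searched `sq_sub_sq`,
`integral_deriv_mul`, `gronwall` with `intervalIntegral`).

## References

* C. Foias, O. Manley, R. Rosa, R. Temam, *Navier–Stokes Equations and Turbulence*, CUP 2001,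
  App. III.A.4 (PDF p. 180).
* R. Temam, *Navier–Stokes Equations*, 3rd ed., North-Holland 1984, Ch. III §1, Lemma 1.2.
-/

noncomputable section

open MeasureTheory Set Filter Topology intervalIntegral

namespace Literature.Analysis.FluidPDE

/-! ### Squares of functions given by an integral identity -/

/-- **Energy identity for a scalar integral equation.** Let `s ≤ t`, let `G` be integrable on
`[s, t]` and suppose `V τ - V s = ∫ₛ^τ G` for every `τ ∈ [s, t]`. Then
`V t ^ 2 - V s ^ 2 = 2 ∫ₛᵗ G τ · V τ dτ` (Temam 1984, Ch. III Lemma 1.2, scalar case: the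
representative `τ ↦ V s + ∫ₛ^τ G` is absolutely continuous with derivative `G` a.e., and
`d/dτ V² = 2 V V'`). [cite: Temam1984, Ch. III §1 Lemma 1.2] -/
theorem sq_sub_sq_eq_integral_of_sub_eq_integral {V G : ℝ → ℝ} {s t : ℝ} (hst : s ≤ t)
    (hG : IntervalIntegrable G volume s t)
    (hV : ∀ τ ∈ Icc s t, V τ - V s = ∫ σ in s..τ, G σ) :
    V t ^ 2 - V s ^ 2 = 2 * ∫ τ in s..t, G τ * V τ := by
  -- the absolutely continuous representative
  set W : ℝ → ℝ := fun τ => V s + ∫ σ in s..τ, G σ with hW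
  have hWV : ∀ τ ∈ Icc s t, W τ = V τ := fun τ hτ => by
    rw [hW]; dsimp only; rw [← hV τ hτ]; ring
  have hsI : s ∈ uIcc s t := by rw [uIcc_of_le hst]; exact left_mem_Icc.2 hst
  have hWac : AbsolutelyContinuousOnInterval W s t := by
    have hc : AbsolutelyContinuousOnInterval (fun _ : ℝ => V s) s t :=
      (contDiffOn_const (c := V s)).absolutelyContinuousOnInterval
    exact hc.add (hG.absolutelyContinuousOnInterval_intervalIntegral hsI)
  -- a.e. derivative of the representative
  have hWd : ∀ᵐ τ, τ ∈ uIcc s t → HasDerivAt W (G τ) τ := by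
    filter_upwards [hG.ae_hasDerivAt_integral] with τ hτ hτI
    have h := (hτ hτI s hsI).const_add (V s)
    exact h
  have hderiv : ∀ᵐ τ, τ ∈ uIoc s t → deriv W τ = G τ := by
    filter_upwards [hWd] with τ hτ hτI
    exact (hτ (uIoc_subset_uIcc hτI)).deriv
  -- product rule for absolutely continuous functions
  have key := hWac.integral_deriv_mul_eq_sub hWac
  have hlhs : ∫ τ in s..t, deriv W τ * W τ + W τ * deriv W τ = ∫ τ in s..t, 2 * (G τ * V τ) := by
    refine integral_congr_ae ?_
    filter_upwards [hderiv] with τ hτ hτI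
    have hτ' : τ ∈ Icc s t := by
      rw [uIoc_of_le hst] at hτI; exact Ioc_subset_Icc_self hτI
    rw [hτ hτI, hWV τ hτ']
    ring
  rw [hlhs, intervalIntegral.integral_const_mul, hWV t (right_mem_Icc.2 hst),
    hWV s (left_mem_Icc.2 hst)] at key
  linarith [key]

/-- Set-integral form of `sq_sub_sq_eq_integral_of_sub_eq_integral`: with the identity and the
conclusion written over `(s, τ]`. [folklore] -/
theorem sq_sub_sq_eq_setIntegral_of_sub_eq_setIntegral {V G : ℝ → ℝ} {s t : ℝ} (hst : s ≤ t)
    (hG : IntegrableOn G (Ioc s t))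
    (hV : ∀ τ ∈ Icc s t, V τ - V s = ∫ σ in Ioc s τ, G σ) :
    V t ^ 2 - V s ^ 2 = 2 * ∫ τ in Ioc s t, G τ * V τ := by
  have hG' : IntervalIntegrable G volume s t := (intervalIntegrable_iff_integrableOn_Ioc_of_le hst).2 hG
  have hV' : ∀ τ ∈ Icc s t, V τ - V s = ∫ σ in s..τ, G σ := fun τ hτ => by
    rw [intervalIntegral.integral_of_le hτ.1]; exact hV τ hτ
  rw [sq_sub_sq_eq_integral_of_sub_eq_integral hst hG' hV', intervalIntegral.integral_of_le hst]

/-! ### A dissipative integral inequality -/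

/-- **Decay from a dissipative integral identity** (the scalar step "`½ d/dt |P₄v|² +
νλ₁|P₄v|² = β(t)`, `β → 0`, whence `|P₄v(t)| → 0`" of FMRT 2001, App. III.A.4, performed on
the integrated identity). Let `c > 0`, `y ≥ 0` continuous on `[s₀, ∞)` with
`y t - y s = ∫ₛᵗ g` for `s₀ ≤ s ≤ t`, `g` integrable on every `[s, t] ⊆ [s₀, ∞)`, and suppose
that for every `ε > 0` there is `S ≥ s₀` with `g τ + c · y τ ≤ ε` for a.e. `τ ≥ S`. Then
`y(t) → 0` as `t → ∞`. Proof: `z = e^{cτ} y` is absolutely continuous on `[s, t]` with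
`z' = e^{cτ}(g + c y) ≤ ε e^{cτ}` a.e., so `y(t) ≤ e^{-c(t-s)} y(s) + ε/c`. [cite: FoiasManleyRosaTemam2001, App. III.A.4 (p. 180)] -/
theorem tendsto_zero_of_integral_dissipative {y g : ℝ → ℝ} {c s₀ : ℝ} (hc : 0 < c)
    (hy0 : ∀ t, s₀ ≤ t → 0 ≤ y t) (hyc : ContinuousOn y (Ici s₀))
    (hg : ∀ s t, s₀ ≤ s → s ≤ t → IntervalIntegrable g volume s t)
    (hid : ∀ s t, s₀ ≤ s → s ≤ t → y t - y s = ∫ τ in s..t, g τ)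
    (hε : ∀ ε, 0 < ε → ∃ S, s₀ ≤ S ∧ ∀ᵐ τ, S ≤ τ → g τ + c * y τ ≤ ε) :
    Tendsto y atTop (𝓝 0) := by
  -- Step 1: the integrating-factor bound `y t ≤ exp (-c (t - s)) * y s + ε / c`
  have hbound : ∀ ε, 0 < ε → ∀ S, s₀ ≤ S → (∀ᵐ τ, S ≤ τ → g τ + c * y τ ≤ ε) →
      ∀ t, S ≤ t → y t ≤ Real.exp (-(c * (t - S))) * y S + ε / c := by
    intro ε hε S hS hae t hSt
    -- the representative of `y` on `[S, t]` and the integrating factor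
    have hgS := hg S t hS hSt
    set W : ℝ → ℝ := fun τ => y S + ∫ σ in S..τ, g σ with hW
    have hWy : ∀ τ ∈ Icc S t, W τ = y τ := fun τ hτ => by
      rw [hW]; dsimp only; rw [← hid S τ hS hτ.1]; ring
    have hSI : S ∈ uIcc S t := by rw [uIcc_of_le hSt]; exact left_mem_Icc.2 hSt
    have hWac : AbsolutelyContinuousOnInterval W S t :=
      (contDiffOn_const (c := y S)).absolutelyContinuousOnInterval.add
        (hgS.absolutelyContinuousOnInterval_intervalIntegral hSI)
    have hEac : AbsolutelyContinuousOnInterval (fun τ => Real.exp (c * τ)) S t :=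
      ((contDiff_const.mul contDiff_id).exp.contDiffOn (s := uIcc S t)).absolutelyContinuousOnInterval
    have hWd : ∀ᵐ τ, τ ∈ uIoc S t → deriv W τ = g τ := by
      filter_upwards [hgS.ae_hasDerivAt_integral] with τ hτ hτI
      exact ((hτ (uIoc_subset_uIcc hτI) S hSI).const_add (y S)).deriv
    have hEd : ∀ τ, deriv (fun τ => Real.exp (c * τ)) τ = c * Real.exp (c * τ) := by
      intro τ
      have h : HasDerivAt (fun τ => Real.exp (c * τ)) (Real.exp (c * τ) * (c * 1)) τ :=
        (((hasDerivAt_id τ).const_mul c)).exp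
      rw [h.deriv]; ring
    have key := hEac.integral_deriv_mul_eq_sub hWac
    -- identify the integrand a.e.: `(e^{cτ})' W + e^{cτ} W' = e^{cτ} (g + c y)`
    have hlhs : ∫ τ in S..t, deriv (fun τ => Real.exp (c * τ)) τ * W τ +
        Real.exp (c * τ) * deriv W τ = ∫ τ in S..t, Real.exp (c * τ) * (g τ + c * y τ) := by
      refine integral_congr_ae ?_
      filter_upwards [hWd] with τ hτ hτI
      have hτ' : τ ∈ Icc S t := by
        rw [uIoc_of_le hSt] at hτI; exact Ioc_subset_Icc_self hτI
      rw [hEd, hτ hτI, hWy τ hτ']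
      ring
    rw [hlhs, hWy t (right_mem_Icc.2 hSt), hWy S (left_mem_Icc.2 hSt)] at key
    -- bound the integral using the a.e. hypothesis
    have hint_exp : IntervalIntegrable (fun τ => Real.exp (c * τ)) volume S t :=
      (Real.continuous_exp.comp (continuous_const.mul continuous_id)).intervalIntegrable _ _
    have hint_lhs : IntervalIntegrable (fun τ => Real.exp (c * τ) * (g τ + c * y τ)) volume S t := by
      have hyI : IntervalIntegrable (fun τ => c * y τ) volume S t := by
        refine ((hyc.mono ?_).intervalIntegrable_of_Icc hSt).const_mul c
        exact fun τ hτ => hS.trans hτ.1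
      refine (hgS.add hyI).continuousOn_mul ?_
      exact (Real.continuous_exp.comp (continuous_const.mul continuous_id)).continuousOn
    have hle : ∫ τ in S..t, Real.exp (c * τ) * (g τ + c * y τ) ≤
        ∫ τ in S..t, Real.exp (c * τ) * ε := by
      refine intervalIntegral.integral_mono_ae_restrict hSt hint_lhs (hint_exp.mul_const ε) ?_
      refine (ae_restrict_iff' measurableSet_Icc).2 ?_
      filter_upwards [hae] with τ hτ hτI
      exact mul_le_mul_of_nonneg_left (hτ hτI.1) (Real.exp_pos _).le
    have hexp_int : ∫ τ in S..t, Real.exp (c * τ) * ε = ε / c * (Real.exp (c * t) - Real.exp (c * S)) := by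
      rw [intervalIntegral.integral_mul_const, integral_comp_mul_left (fun τ => Real.exp τ) hc.ne',
        integral_exp, smul_eq_mul]
      field_simp
    have hexp_le : ε / c * (Real.exp (c * t) - Real.exp (c * S)) ≤ ε / c * Real.exp (c * t) := by
      have := Real.exp_pos (c * S)
      have hεc : 0 ≤ ε / c := div_nonneg hε.le hc.le
      nlinarith
    -- conclude
    have hz : Real.exp (c * t) * y t ≤ Real.exp (c * S) * y S + ε / c * Real.exp (c * t) := by
      linarith [key, hle, hexp_int, hexp_le]
    have hpos : 0 < Real.exp (c * t) := Real.exp_pos _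
    have h' : y t ≤ (Real.exp (c * S) * y S + ε / c * Real.exp (c * t)) / Real.exp (c * t) := by
      rw [le_div_iff₀ hpos]; linarith [hz, mul_comm (Real.exp (c * t)) (y t)]
    refine h'.trans_eq ?_
    rw [show -(c * (t - S)) = c * S - c * t by ring, Real.exp_sub]
    field_simp
  -- Step 2: `y → 0`
  rw [Metric.tendsto_atTop]
  intro δ hδ
  obtain ⟨S, hS, hae⟩ := hε (c * (δ / 2)) (by positivity)
  have hb := hbound (c * (δ / 2)) (by positivity) S hS hae
  -- `exp (-c (t - S)) * y S < δ / 2` for large `t`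
  have hdecay : Tendsto (fun t => Real.exp (-(c * (t - S))) * y S) atTop (𝓝 0) := by
    have h1 : Tendsto (fun t => -(c * (t - S))) atTop atBot := by
      have : Tendsto (fun t => c * (t - S)) atTop atTop :=
        Tendsto.const_mul_atTop hc (tendsto_atTop_add_const_right _ (-S) tendsto_id)
      exact tendsto_neg_atTop_atBot.comp this
    have h2 := Real.tendsto_exp_atBot.comp h1
    simpa using h2.mul_const (y S)
  obtain ⟨N, hN⟩ := (Metric.tendsto_atTop.1 hdecay) (δ / 2) (by positivity)
  refine ⟨max S N, fun t ht => ?_⟩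
  have htS : S ≤ t := (le_max_left _ _).trans ht
  have htN : N ≤ t := (le_max_right _ _).trans ht
  have h1 := hb t htS
  have h2 := hN t htN
  rw [Real.dist_eq, sub_zero, abs_lt] at h2
  rw [Real.dist_eq, sub_zero, abs_of_nonneg (hy0 t (hS.trans htS))]
  have h3 : c * (δ / 2) / c = δ / 2 := by field_simp
  rw [h3] at h1
  linarith [h2.2]

/-! ### Continuous representatives vanishing almost everywhere -/

/-- A function continuous on `(a, b]` which vanishes for a.e. `t ∈ (a, b)` vanishes at every
`t ∈ (a, b]`: the set where it is nonzero is relatively open in `(a, b]`, hence contains an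
interval `(t - δ, t)` of positive measure if nonempty. [folklore] -/
theorem eq_zero_of_continuousOn_Ioc_of_ae_eq_zero {E : Type*} [NormedAddCommGroup E]
    {g : ℝ → E} {a b : ℝ} (hg : ContinuousOn g (Ioc a b))
    (hae : ∀ᵐ t ∂(volume.restrict (Ioo a b)), g t = 0) {t : ℝ} (ht : t ∈ Ioc a b) :
    g t = 0 := by
  by_contra hne
  have hpos : 0 < ‖g t‖ := norm_pos_iff.2 hne
  -- continuity within `(a, b]` at `t`
  have hct := hg t ht
  rw [Metric.continuousWithinAt_iff] at hct
  obtain ⟨δ, hδ, hδ'⟩ := hct (‖g t‖) hpos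
  -- the interval `(max a (t - δ), t)` is contained in the bad set
  set l := max a (t - δ) with hl
  have hlt : l < t := max_lt ht.1 (by linarith)
  have hsub : Ioo l t ⊆ {s | g s ≠ 0} := by
    intro s hs
    have hsI : s ∈ Ioc a b := ⟨(le_max_left _ _).trans_lt hs.1, hs.2.le.trans ht.2⟩
    have hsd : dist s t < δ := by
      rw [Real.dist_eq, abs_lt]
      constructor <;> linarith [hs.1, hs.2, le_max_right a (t - δ)]
    have h := hδ' hsI hsd
    intro hs0
    rw [hs0, dist_zero_left] at h
    exact lt_irrefl _ h
  -- but the bad set is null in `(a, b)`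
  have hnull : volume.restrict (Ioo a b) {s | g s ≠ 0} = 0 := by
    rw [ae_iff] at hae
    simpa using hae
  have hIoo : volume.restrict (Ioo a b) (Ioo l t) = 0 :=
    measure_mono_null hsub hnull
  rw [Measure.restrict_apply measurableSet_Ioo, Ioo_inter_Ioo, Real.volume_Ioo] at hIoo
  have h1 : max l a = l := max_eq_left (le_max_left _ _)
  have h2 : min t b = t := min_eq_left ht.2
  rw [h1, h2] at hIoo
  have : (0 : ℝ) < t - l := by linarith
  rw [ENNReal.ofReal_eq_zero] at hIoo
  linarith

end Literature.Analysis.FluidPDE
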